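import Summits.QuantumFields.YangMills.Theorems.BalabanUVNodesPortS1ChartLawPointwise
import Summits.QuantumFields.YangMills.Theorems.BalabanUVNodesPortS1ChartOffCentral
import Summits.QuantumFields.YangMills.Theorems.BalabanUVNodesPortS1ChartJacobianFull

/-!
# NODE O port PT-A — FE-1's chart law (T1), THE ASSEMBLY (B-★) of `Lines/pta_residueW-LOCATING-S1-Bstar-v2.md` §3: THE TRANSFORM OF RECORD IS THE SOLVED-FORM (2.10) INTEGRAL over DEF-1's
# remaining variables `y : NonB0Idx → ℝ`, at the EXPLICIT graph point `Y(W, y) = recordReparamOf … (ctr W) 1 (C·y)` with the EXPLICIT density `σ₀^{#{b∉β}} · fluctSigma(fluctVec Y) · Π_c |det D_a q_c|⁻¹`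
# — [I] (2.10) p.267 «= 𝐍* ∫ dB′ σ(B′) δ(Q̃(B′)) χ_k exp[…]» with the δ-function SOLVED for `B′(b₀(c))` (p.268 L1–3), a.e. in the coarse field and pointwise under displayed continuity

Cell `ym-nodeO-ideate`, porter seat PT-A-1 (gen 14); `--kind proof --supports stmt-QuantumFields-27930 --as helper`; count-neutral.  [I] = [Balaban1987RG1]; [16] = [Balaban1985UV3].
Docket ★★★ director-ym №678 (2)(iii) ∕ №684 (2); statement = memo v2 §3 (STAR-FLAT-CHECK-v1 (C4): NO `σ₀` in the per-bond density).  Over part 1 ✓`…PortS1ChartLawPointwise`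
(`privateIntegrand_chart_eq_indicator_solved`), ✓`…PortS1ChartOffCentral` (N11's blind sharp bundle + transport identity, 27 clauses), ✓`…ChartJacobianFull` (`integral_pi_haar_eq_chart`),
✓`…ChartRem` (`setIntegral_pi_ball_eq_setIntegral_remWindow`), dag-n11 ✓`measurable_privateChart`∕`measurable_privateJacobian`, Node00 ✓`TcanOfRecord_eqOn_of_continuousOn`.

WHAT IS PROVED (0 `def`, 0 `sorry`).  ★★★ `transportOfRecord_ae_eq_integral_solvedChart` ((★-ae): for `dV`-a.e. `W` with `Ū(ctr W) = W` and loops of `ctr W` `≤ αD`,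
`transportOfRecord F 2 K k ρ W = σ₀^{#{b∉range β}} · ∫_{remWindow r} fluctSigma(fluctVec Y) · (Π_c |det_c|)⁻¹ · ρ(pert (ctr W) Y) dy`) · ★★★ `TcanOfRecord_eq_integral_solvedChart_of_continuousOn`
((★): the same for the CANONICAL transform at EVERY point of any open `U₀` carrying `Ū ∘ ctr = id`, loops `≤ αD` and continuity of the right-hand side).

HONEST FRAMING.  An identity between two readings of one fibre integral; every estimate-free hypothesis is displayed: N11's window numerics (N), the loop budget (B1), the `D̃`-ball condition
`hCr` (B2, the consumer's), the support clause (S), and — for the pointwise form — the continuity `hgc` (the consumer's).  Nothing of (2.11)–(2.14) (the Gaussian normalisation, `Tr log`, the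
fluctuation integral) is here: that is (B-T2), NOT authorised (№678 (2)(iv)).  No Bałaban estimate asserted, ported or discharged; `FEChartLawReg`∕`FEPolymerActivitiesReg`∕`P0HolExtAtRecordGL`∕
`ClassP2Reg`∕`RegSelSmoothOnClass`∕`RegClassNestsUc` inhabited NOWHERE; ⟨27930⟩ OPEN 2∕7 · no claim; NODE O 0∕1; COUNT 8∕28 · K 1∕4 · legs 0∕6 UNMOVED; finite `𝕋⁴_{L^K}` at fixed ε — NOT
continuum ∕ OS; **the Yang–Mills mass gap (Clay) is NOT proved by any of this.**  No `sorry`, no `def`, no `instance`; standard axioms only.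
-/

noncomputable section

open MeasureTheory MeasureTheory.Measure Set Metric Function Filter Topology
open scoped ENNReal NNReal BigOperators Matrix.Norms.L2Operator

namespace Summit.QuantumFields.YangMills.Theorems.BalabanUVNodesPortS1

open Literature.MathematicalPhysics.QuantumFieldTheory (haarProbability)
open Literature.MathematicalPhysics.QuantumFieldTheory.Balaban1983to89
open Literature.MathematicalPhysics.QuantumFieldTheory.Balaban1983to89.Node00
open Literature.MathematicalPhysics.QuantumFieldTheory.Balaban1983to89.T4Continuum (T4Family)
open Literature.MathematicalPhysics.QuantumFieldTheory.Balaban1983to89.B10Eq22Rescaling (sigmaSU2 sigmaSU2_zero)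
open Literature.MathematicalPhysics.QuantumFieldTheory.Balaban1983to89.B10Eq18SigmaSU2Haar
open Literature.MathematicalPhysics.QuantumFieldTheory.Balaban1983to89.BlockAveraging (avgFun loopHol Small Idx)
open Literature.MathematicalPhysics.QuantumFieldTheory.Balaban1983to89.BlockAveragingHaarAC (centralBond pre post centralBond_injective)
open Literature.MathematicalPhysics.QuantumFieldTheory.Balaban1983to89.BlockAveragingEMLHaarAC (fibreFamily offCard)
open Literature.MathematicalPhysics.QuantumFieldTheory.Balaban1983to89.ExpMeanLog (expMeanLogSU deltaSU)
open Summit.QuantumFields.YangMills.Theorems.K0RecordFormatNames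
open Summit.QuantumFields.YangMills.Theorems.BalabanUVNodesN11TransportOfRecordInPrivateCoordinateChart (succ_le_m_add_K measurable_privateChart measurable_privateJacobian)
open _root_.Matrix

variable (F : T4Family)

/-! ## §3  The transform of record is the solved-form (2.10) integral -/

section Main

variable {F}

/-- ★★★ **(★-ae) THE TRANSFORM OF RECORD IS THE SOLVED-FORM (2.10) INTEGRAL, `dV`-a.e.** (memo `LOCATING-S1-Bstar-v2` §3).  At step `k < K`, under N11's window numerics (N), the loop budget (B1)
`αD + (d+2)L·(e^{3R} − 1) ≤ α`, a chart radius `r ≤ R` with the `D̃`-ball condition `hCr` (B2), and the support clause (S) on the measurable integrable density `ρ` (loops STRICTLY `< α` and the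
chart window of radius `r` around the centre `ctr` of its own fibre): for `dV`-a.e. coarse field `W` with `Ū(ctr W) = W` and loops of `ctr W` at most `αD`,
`transportOfRecord F 2 K k ρ W = σ₀^{#{b ∉ range β}} · ∫_{remWindow r} fluctSigma(fluctVec Y(W,y)) · (Π_c |det D_a q_c(W,y)|)⁻¹ · ρ(pert (ctr W) Y(W,y)) dy`, `Y(W,y) = recordReparamOf … (ctr W) 1 (C·y)`
the graph point and `q_c` the `β c`-slot chart read of DEF-1's `Q̃_c` — [I] (2.10) with `δ(Q̃(B′))` solved for `B′(b₀(c))`, NO `σ₀` in the per-bond density (STAR-FLAT-CHECK-v1 (C4)).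
[cite: Balaban1987RG1, (2.10) p.267, p.268 L1–3, (2.4) p.266, (2.9) p.266, (0.19) p.255] [cite: Balaban1985UV3, (16) p.259, (18) p.260] -/
theorem transportOfRecord_ae_eq_integral_solvedChart {K k : ℕ} (hk : k < K) {α αD r : ℝ} (hα0 : 0 ≤ α) (hα : α ≤ 1 / 24) (hα64 : 64 * α ≤ deltaSU (Fin 2))
    (hαL : 157 * α < (((F.P K).L : ℝ) ^ ((F.P K).d - 1))⁻¹)
    (hgap : ∀ c : PBond (F.P K) (k + 1), (offCard c : ℝ) / (Fintype.card (Idx (F.P K)) : ℝ) + 150 * α < 1)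
    (hbudget : αD + ((((F.P K).d + 2) * (F.P K).L : ℕ) : ℝ) * (Real.exp (3 * (1 / (10 ^ 8 * (F.P K).d * (F.P K).L))) - 1) ≤ α)
    (hrR : r ≤ 1 / (10 ^ 8 * (F.P K).d * (F.P K).L)) {ρD : ℝ}
    (hρD : ρD = (min ((1 : ℝ) / (10 ^ 8 * (F.P K).d * (F.P K).L) / 3) (1 / (18 * (2 * 1 / (1 / (10 ^ 8 * (F.P K).d * (F.P K).L)) ^ 2) * ((6 / ((((F.P K).L : ℝ) ^ ((F.P K).d - 1))⁻¹ - 157 * αD)) + 1)))))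
    (ctr : (PBond (F.P K) (k + 1) → SU 2) → GaugeField (F.P K) k (SU 2))
    (hCr : ∀ W : PBond (F.P K) (k + 1) → SU 2, (avOfRecord F 2 K k).avg (ctr W) = W → (∀ (c : PBond (F.P K) (k + 1)) (i : Idx (F.P K)), dist1 (loopHol (ctr W) c i) ≤ αD) →
      ∀ y : NonB0Idx F k K → ℝ, (∀ (b : PBond (F.P K) k) (hb : b ∉ Set.range (recordB0 F k K)), √(∑ a : Fin 3, y ⟨(b, a), hb⟩ ^ 2) < r) →
        ‖(fun i => ((((1 : ℝ) • (recordCopFluct F k K (ctr W) *ᵥ y)) i : ℝ) : ℂ))‖ < ρD)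
    {ρ : Density (F.P K) k (SU 2)} (hρm : Measurable ρ) (hρ : Integrable ρ (fieldMeasure (F.P K) k (SU 2)))
    (hS : ∀ U, ρ U ≠ 0 → (∀ (c : PBond (F.P K) (k + 1)) (i : Idx (F.P K)), dist1 (loopHol U c i) < α) ∧
      ∃ x : FluctIdx F k K → ℝ, (∀ b, ‖fluctVec F k K x b‖ < r) ∧ U = pert F k K (ctr ((avOfRecord F 2 K k).avg U)) x) :
    ∀ᵐ W ∂(fieldMeasure (F.P K) (k + 1) (SU 2)),
      ((avOfRecord F 2 K k).avg (ctr W) = W ∧ ∀ (c : PBond (F.P K) (k + 1)) (i : Idx (F.P K)), dist1 (loopHol (ctr W) c i) ≤ αD) →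
      transportOfRecord F 2 K k ρ W =
        (sigmaSU2 0) ^ Fintype.card {b : PBond (F.P K) k // b ∉ Set.range (recordB0 F k K)} *
          ∫ y in {y : NonB0Idx F k K → ℝ | ∀ (b : PBond (F.P K) k) (hb : b ∉ Set.range (recordB0 F k K)), √(∑ a : Fin 3, y ⟨(b, a), hb⟩ ^ 2) < r},
            fluctSigma (fluctVec F k K (recordReparamOf F k (fun Vk => recordDt F k K Vk ρD) (ctr W) 1 (recordCopFluct F k K (ctr W) *ᵥ y))) *
          ((∏ c : PBond (F.P K) (k + 1),
              |(fderiv ℝ (fun a : EuclideanSpace ℝ (Fin 3) =>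
                  (WithLp.toLp 2 (su2Coord (recordQt F k K (ctr W) ((fluctVec F k K).symm (update (fluctVec F k K
                    (recordReparamOf F k (fun Vk => recordDt F k K Vk ρD) (ctr W) 1 (recordCopFluct F k K (ctr W) *ᵥ y))) (centralBond c) a)) c)) : EuclideanSpace ℝ (Fin 3)))
                (fluctVec F k K (recordReparamOf F k (fun Vk => recordDt F k K Vk ρD) (ctr W) 1 (recordCopFluct F k K (ctr W) *ᵥ y)) (centralBond c))).det|)⁻¹ *
            ρ (pert F k K (ctr W) (recordReparamOf F k (fun Vk => recordDt F k K Vk ρD) (ctr W) 1 (recordCopFluct F k K (ctr W) *ᵥ y)))) := by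
  have hkr : k + 1 ≤ (F.P K).m + (F.P K).K := succ_le_m_add_K hk
  have hd : (1 : ℝ) ≤ (F.P K).d := by exact_mod_cast (F.P K).hd
  have hL : (1 : ℝ) ≤ (F.P K).L := by exact_mod_cast (F.P K).hL.2.le
  have hRpos : (0 : ℝ) < 1 / (10 ^ 8 * (F.P K).d * (F.P K).L) := by positivity
  have hRle : (1 : ℝ) / (10 ^ 8 * (F.P K).d * (F.P K).L) ≤ 1 / 10 ^ 8 := one_div_le_one_div_of_le (by positivity) (by nlinarith)
  have hrπ : r < Real.pi := by linarith [hrR.trans hRle, Real.pi_gt_three]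
  -- `αD ≤ α`, hence `157αD < L^{1−d}`
  have hαDL : 157 * αD < (((F.P K).L : ℝ) ^ ((F.P K).d - 1))⁻¹ := by
    have h1 : (0 : ℝ) ≤ ((((F.P K).d + 2) * (F.P K).L : ℕ) : ℝ) * (Real.exp (3 * (1 / (10 ^ 8 * (F.P K).d * (F.P K).L))) - 1) :=
      mul_nonneg (Nat.cast_nonneg _) (by linarith [Real.add_one_le_exp (3 * (1 / (10 ^ 8 * ((F.P K).d : ℝ) * (F.P K).L)))])
    linarith
  classical
  obtain ⟨T, ϑ, jd, jac', hTm, hθm, hjm, hright, -, hTim, hleft, -, hQ, -, hjacm, hjac0, hfwd, hjacc, -, -, -, -, -, hTbl, hθbl, hjbl, -, htr⟩ :=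
    transportOfRecord_ae_eq_integral_offCentral_sharp_record (F := F) (N := 2) hk hα0 hα hα64 hαL hgap (fun _ => (1 : SU 2))
  have hae := htr hρm hρ (fun U hU c i => ((hS U hU).1 c i).le)
  filter_upwards [hae] with W hWeq hG
  obtain ⟨hW, hWD⟩ := hG
  rw [hWeq]
  -- measurability of N11's integrand at `W` and of the dummy fill
  have hfm : Measurable fun U : GaugeField (F.P K) k (SU 2) =>
      (({p : GaugeField (F.P K) (k + 1) (SU 2) × GaugeField (F.P K) k (SU 2) | ∀ c, p.1 c ∈ T c p.2}.indicator
          (fun p => ∏ c, jd c p.2 (p.1 c)) (W, U) : ℝ≥0) : ℝ) * ρ (extend centralBond (fun c => ϑ c U (W c)) U) := by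
    have h1 : Measurable fun U : GaugeField (F.P K) k (SU 2) =>
        {p : GaugeField (F.P K) (k + 1) (SU 2) × GaugeField (F.P K) k (SU 2) | ∀ c, p.1 c ∈ T c p.2}.indicator (fun p => ∏ c, jd c p.2 (p.1 c)) (W, U) :=
      (measurable_privateJacobian T jd hTm hjm).comp (measurable_const.prodMk measurable_id)
    have h2 : Measurable fun U : GaugeField (F.P K) k (SU 2) => (extend centralBond (fun c => ϑ c U (W c)) U : GaugeField (F.P K) k (SU 2)) :=
      (measurable_privateChart ϑ hk hθm).comp (measurable_const.prodMk measurable_id)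
    exact (measurable_coe_nnreal_real.comp h1).mul (hρm.comp h2)
  have hfill : Measurable fun U' : {b : PBond (F.P K) k // b ∉ Set.range (recordB0 F k K)} → SU 2 =>
      (fun b => if h : b ∈ Set.range (centralBond : PBond (F.P K) (k + 1) → PBond (F.P K) k) then (1 : SU 2) else U' ⟨b, h⟩ :
        GaugeField (F.P K) k (SU 2)) := by
    refine measurable_pi_lambda _ fun b => ?_
    by_cases h : b ∈ Set.range (centralBond : PBond (F.P K) (k + 1) → PBond (F.P K) k)
    · simp only [dif_pos h]; exact measurable_const
    · simp only [dif_neg h]; exact measurable_pi_apply _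
  -- step 1: the off-central Haar integral in the Pauli chart at centre `ctr W|off` (✓`integral_pi_haar_eq_chart`; `HaarData.haar = haarProbability`, `rfl`)
  have step1 := integral_pi_haar_eq_chart (fun b' : {b : PBond (F.P K) k // b ∉ Set.range (recordB0 F k K)} => ctr W b'.1)
    (fun U' : {b : PBond (F.P K) k // b ∉ Set.range (recordB0 F k K)} → Matrix.specialUnitaryGroup (Fin 2) ℂ =>
      (({p : GaugeField (F.P K) (k + 1) (SU 2) × GaugeField (F.P K) k (SU 2) | ∀ c, p.1 c ∈ T c p.2}.indicator
          (fun p => ∏ c, jd c p.2 (p.1 c))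
            (W, fun b => if h : b ∈ Set.range (centralBond : PBond (F.P K) (k + 1) → PBond (F.P K) k) then (1 : SU 2) else U' ⟨b, h⟩) : ℝ≥0) : ℝ) *
        ρ (extend centralBond
          (fun c => ϑ c (fun b => if h : b ∈ Set.range (centralBond : PBond (F.P K) (k + 1) → PBond (F.P K) k) then (1 : SU 2) else U' ⟨b, h⟩) (W c))
          (fun b => if h : b ∈ Set.range (centralBond : PBond (F.P K) (k + 1) → PBond (F.P K) k) then (1 : SU 2) else U' ⟨b, h⟩)))
    (hfm.comp hfill).aestronglyMeasurable
  refine step1.trans ?_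
  rw [smul_eq_mul]
  congr 1
  -- step 2: onto DEF-1's carrier `y : NonB0Idx → ℝ`
  rw [setIntegral_pi_ball_eq_setIntegral_remWindow F k K Real.pi]
  -- step 3: pointwise in `y` (§2), then the window
  refine (setIntegral_congr_fun (measurableSet_remWindow F k K Real.pi) fun y hy =>
    privateIntegrand_chart_eq_indicator_solved hk hαDL hbudget hrR hρD hjacm hright hTim hleft hQ hjac0 hfwd hjacc hTbl hθbl hjbl ctr hW hWD (hCr W hW hWD) hS
      (fun _ => (1 : SU 2)) y hy).trans ?_
  rw [setIntegral_indicator (measurableSet_remWindow F k K r)]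
  have hsub : {y : NonB0Idx F k K → ℝ | ∀ (b : PBond (F.P K) k) (hb : b ∉ Set.range (recordB0 F k K)), √(∑ a : Fin 3, y ⟨(b, a), hb⟩ ^ 2) < r} ⊆
      {y : NonB0Idx F k K → ℝ | ∀ (b : PBond (F.P K) k) (hb : b ∉ Set.range (recordB0 F k K)), √(∑ a : Fin 3, y ⟨(b, a), hb⟩ ^ 2) < Real.pi} :=
    fun y hy b hb => (hy b hb).trans hrπ
  rw [inter_eq_right.2 hsub]

/-- ★★★ **(★) POINTWISE ON EVERY OPEN SET CARRYING CONTINUITY OF THE RIGHT-HAND SIDE**: under the hypotheses of ✓`transportOfRecord_ae_eq_integral_solvedChart`, on any OPEN `U₀` whose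
points satisfy `Ū(ctr W) = W`, loops of `ctr W` `≤ αD`, and on which the solved-form integral is continuous in `W` (the consumer's `hgc`), the CANONICAL transform of record EQUALS it at EVERY
`W ∈ U₀` (Node00 ✓`TcanOfRecord_eqOn_of_continuousOn`). [cite: Balaban1987RG1, (2.10) p.267, (0.19) p.255, p.259] [cite: Balaban1985UV3, (18) p.260] -/
theorem TcanOfRecord_eq_integral_solvedChart_of_continuousOn {K k : ℕ} (hk : k < K) {α αD r : ℝ} (hα0 : 0 ≤ α) (hα : α ≤ 1 / 24) (hα64 : 64 * α ≤ deltaSU (Fin 2))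
    (hαL : 157 * α < (((F.P K).L : ℝ) ^ ((F.P K).d - 1))⁻¹)
    (hgap : ∀ c : PBond (F.P K) (k + 1), (offCard c : ℝ) / (Fintype.card (Idx (F.P K)) : ℝ) + 150 * α < 1)
    (hbudget : αD + ((((F.P K).d + 2) * (F.P K).L : ℕ) : ℝ) * (Real.exp (3 * (1 / (10 ^ 8 * (F.P K).d * (F.P K).L))) - 1) ≤ α)
    (hrR : r ≤ 1 / (10 ^ 8 * (F.P K).d * (F.P K).L)) {ρD : ℝ}
    (hρD : ρD = (min ((1 : ℝ) / (10 ^ 8 * (F.P K).d * (F.P K).L) / 3) (1 / (18 * (2 * 1 / (1 / (10 ^ 8 * (F.P K).d * (F.P K).L)) ^ 2) * ((6 / ((((F.P K).L : ℝ) ^ ((F.P K).d - 1))⁻¹ - 157 * αD)) + 1)))))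
    (ctr : (PBond (F.P K) (k + 1) → SU 2) → GaugeField (F.P K) k (SU 2))
    (hCr : ∀ W : PBond (F.P K) (k + 1) → SU 2, (avOfRecord F 2 K k).avg (ctr W) = W → (∀ (c : PBond (F.P K) (k + 1)) (i : Idx (F.P K)), dist1 (loopHol (ctr W) c i) ≤ αD) →
      ∀ y : NonB0Idx F k K → ℝ, (∀ (b : PBond (F.P K) k) (hb : b ∉ Set.range (recordB0 F k K)), √(∑ a : Fin 3, y ⟨(b, a), hb⟩ ^ 2) < r) →
        ‖(fun i => ((((1 : ℝ) • (recordCopFluct F k K (ctr W) *ᵥ y)) i : ℝ) : ℂ))‖ < ρD)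
    {ρ : Density (F.P K) k (SU 2)} (hρm : Measurable ρ) (hρ : Integrable ρ (fieldMeasure (F.P K) k (SU 2)))
    (hS : ∀ U, ρ U ≠ 0 → (∀ (c : PBond (F.P K) (k + 1)) (i : Idx (F.P K)), dist1 (loopHol U c i) < α) ∧
      ∃ x : FluctIdx F k K → ℝ, (∀ b, ‖fluctVec F k K x b‖ < r) ∧ U = pert F k K (ctr ((avOfRecord F 2 K k).avg U)) x)
    {U₀ : Set (PBond (F.P K) (k + 1) → SU 2)} (hU : IsOpen U₀)
    (hUG : ∀ W ∈ U₀, (avOfRecord F 2 K k).avg (ctr W) = W ∧ ∀ (c : PBond (F.P K) (k + 1)) (i : Idx (F.P K)), dist1 (loopHol (ctr W) c i) ≤ αD)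
    (hgc : ContinuousOn (fun W : PBond (F.P K) (k + 1) → SU 2 =>
      (sigmaSU2 0) ^ Fintype.card {b : PBond (F.P K) k // b ∉ Set.range (recordB0 F k K)} *
        ∫ y in {y : NonB0Idx F k K → ℝ | ∀ (b : PBond (F.P K) k) (hb : b ∉ Set.range (recordB0 F k K)), √(∑ a : Fin 3, y ⟨(b, a), hb⟩ ^ 2) < r},
          fluctSigma (fluctVec F k K (recordReparamOf F k (fun Vk => recordDt F k K Vk ρD) (ctr W) 1 (recordCopFluct F k K (ctr W) *ᵥ y))) *
          ((∏ c : PBond (F.P K) (k + 1),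
              |(fderiv ℝ (fun a : EuclideanSpace ℝ (Fin 3) =>
                  (WithLp.toLp 2 (su2Coord (recordQt F k K (ctr W) ((fluctVec F k K).symm (update (fluctVec F k K
                    (recordReparamOf F k (fun Vk => recordDt F k K Vk ρD) (ctr W) 1 (recordCopFluct F k K (ctr W) *ᵥ y))) (centralBond c) a)) c)) : EuclideanSpace ℝ (Fin 3)))
                (fluctVec F k K (recordReparamOf F k (fun Vk => recordDt F k K Vk ρD) (ctr W) 1 (recordCopFluct F k K (ctr W) *ᵥ y)) (centralBond c))).det|)⁻¹ *
            ρ (pert F k K (ctr W) (recordReparamOf F k (fun Vk => recordDt F k K Vk ρD) (ctr W) 1 (recordCopFluct F k K (ctr W) *ᵥ y))))) U₀) :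
    EqOn (TcanOfRecord F 2 K k ρ) (fun W : PBond (F.P K) (k + 1) → SU 2 =>
      (sigmaSU2 0) ^ Fintype.card {b : PBond (F.P K) k // b ∉ Set.range (recordB0 F k K)} *
        ∫ y in {y : NonB0Idx F k K → ℝ | ∀ (b : PBond (F.P K) k) (hb : b ∉ Set.range (recordB0 F k K)), √(∑ a : Fin 3, y ⟨(b, a), hb⟩ ^ 2) < r},
          fluctSigma (fluctVec F k K (recordReparamOf F k (fun Vk => recordDt F k K Vk ρD) (ctr W) 1 (recordCopFluct F k K (ctr W) *ᵥ y))) *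
          ((∏ c : PBond (F.P K) (k + 1),
              |(fderiv ℝ (fun a : EuclideanSpace ℝ (Fin 3) =>
                  (WithLp.toLp 2 (su2Coord (recordQt F k K (ctr W) ((fluctVec F k K).symm (update (fluctVec F k K
                    (recordReparamOf F k (fun Vk => recordDt F k K Vk ρD) (ctr W) 1 (recordCopFluct F k K (ctr W) *ᵥ y))) (centralBond c) a)) c)) : EuclideanSpace ℝ (Fin 3)))
                (fluctVec F k K (recordReparamOf F k (fun Vk => recordDt F k K Vk ρD) (ctr W) 1 (recordCopFluct F k K (ctr W) *ᵥ y)) (centralBond c))).det|)⁻¹ *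
            ρ (pert F k K (ctr W) (recordReparamOf F k (fun Vk => recordDt F k K Vk ρD) (ctr W) 1 (recordCopFluct F k K (ctr W) *ᵥ y))))) U₀ := by
  have h := transportOfRecord_ae_eq_integral_solvedChart hk hα0 hα hα64 hαL hgap hbudget hrR hρD ctr hCr hρm hρ hS
  refine TcanOfRecord_eqOn_of_continuousOn hU hgc ?_
  rw [piHaar_eq_fieldMeasure]
  filter_upwards [ae_restrict_mem hU.measurableSet, ae_restrict_of_ae h] with W hWU hW
  exact (hW (hUG W hWU)).symm

end Main

end Summit.QuantumFields.YangMills.Theorems.BalabanUVNodesPortS1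

end
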